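import Summits.ValiantsHypothesis.ValiantsHypothesis.Theorems.SymPencilPerFourBlockPermRank
import Summits.ValiantsHypothesis.ValiantsHypothesis.Theorems.SymPencilPerFourHessianRankDispatch
import Literature.Computability.AlgebraicComplexity.ThreeByThreeGenericRestriction

/-!
# Route `SymPencil` — the toric case: all rows and columns of rank `≤ 2`
# (Case C of Task T1 of `Cruxes/SdcSuperquadratic/NEXT-RUNG-23.md`;
# `--supports` stmt-ValiantsHypothesis-5674 `SdcSuperquadratic`)

Let `W` be a subspace of `4 × 4` matrices on which all `3 × 3` subpermanents vanish (H3), all of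
whose rows and columns have rank `≤ 2`.  Then `dim W ≤ 6` (`finrank_le_six_of_ranks_le_two`; the
swapped property is not even needed here).

Proof.  Suppose `dim W ≥ 7`.  (1) Peeling three rows (each of rank `≤ 2`) leaves a non-zero
element supported in the fourth row: `W` has SINGLE-ROW elements in every row, and single-column
elements in every column.  (2) H3 on (single row `b`) + (single row `c`) + (single column `j`),
rows `(i, b, c)`, columns `(j, p, q)`: `ζ_{ij} · per₂(z_b, z_c; p, q) = 0`.  (3) Fix a single-column
element `ζ` in column `j` and a row `a` with `ζ_{aj} ≠ 0`: the single-row elements of the three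
other rows, restricted off column `j`, are pairwise perm-orthogonal; if one of them vanishes off
column `j` it is a MATRIX UNIT `E_{rj} ∈ W`; otherwise they share a one-point support `l₀`
(`SymPencilPerFourBlockPerm.common_support_of_perm_orth₃`) and column `l₀` has rank `3` —
excluded.  (4) A unit `E_{rj} ∈ W` kills (H3, linearly in `t`) all `2 × 2` subpermanents avoiding
row `r` and column `j`; peeling row `r` and column `j` (ranks `≤ 2`) leaves a block space of
dimension `≥ 3`, contradicting `SymPencilPerFourBlockPermRank.finrank_le_two_of_block_perm`.

With the dispatcher `SymPencilPerFourHessianRankDispatch.finrank_le_six_of_toric` this completes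
Task T1: **under H3 and `rank (Hess per_4) ≤ 5` on `W`, `dim W ≤ 6`** (`finrank_le_six_of_sum_sq_swap`).

Honest framing: the last brick of T1; the rung `sdc(per_4) ≥ 25` is assembled in a separate file;
the crux `SdcSuperquadratic` stays open; `VP ≠ VNP` is not moved. [folklore]
-/

noncomputable section

-- single-conjunct layout: Sub = Summit, duplicated namespace component intended
set_option linter.dupNamespace false

namespace Summit.ValiantsHypothesis.ValiantsHypothesis.Theorems.SymPencilPerFourHessianToric

open Matrix MvPolynomial Finset Module
open Literature.Computability.AlgebraicComplexity
open Literature.Computability.AlgebraicComplexity.AlperBogartVelasco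
open Summit.ValiantsHypothesis.ValiantsHypothesis.Theorems.SymPencilPerFourTwoRowsPerm
open Summit.ValiantsHypothesis.ValiantsHypothesis.Theorems.SymPencilPerFourBlockPerm
open Summit.ValiantsHypothesis.ValiantsHypothesis.Theorems.SymPencilPerFourBlockPermRank
open Summit.ValiantsHypothesis.ValiantsHypothesis.Theorems.SymPencilPerFourHessianRankThreeZero
open Summit.ValiantsHypothesis.ValiantsHypothesis.Theorems.SymPencilPerFourHessianRankDispatch

variable {K : Type*} [Field K]

/-- The three other elements of `Fin 4`. [folklore] -/
theorem exists_three_others (d : Fin 4) : ∃ a b c : Fin 4, a ≠ b ∧ a ≠ c ∧ b ≠ c ∧ a ≠ d ∧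
    b ≠ d ∧ c ≠ d ∧ ∀ i : Fin 4, i = d ∨ i = a ∨ i = b ∨ i = c := by
  revert d; decide

/-- **Single-row elements.**  If all rows of `W` have rank `≤ 2` and `dim W ≥ 7`, every row `d`
carries a non-zero element of `W` supported in row `d`. [folklore] -/
theorem exists_single_row (W : Submodule K (Fin 4 × Fin 4 → K))
    (hrow : ∀ r : Fin 4, finrank K (W.map (LinearMap.funLeft K K fun l : Fin 4 => (r, l))) ≤ 2)
    (h7 : 7 ≤ finrank K W) (d : Fin 4) :
    ∃ z ∈ W, z ≠ 0 ∧ ∀ i, i ≠ d → ∀ l, z (i, l) = 0 := by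
  classical
  obtain ⟨a, b, c, hab, hac, hbc, had, hbd, hcd, hall⟩ := exists_three_others d
  let ρ : Fin 4 → (Fin 4 × Fin 4 → K) →ₗ[K] (Fin 4 → K) :=
    fun r => LinearMap.funLeft K K fun l : Fin 4 => (r, l)
  have hρ : ∀ r x l, ρ r x l = x (r, l) := fun _ _ _ => rfl
  have hrow' : ∀ r, finrank K (W.map (ρ r)) ≤ 2 := fun r => hrow r
  set W₁ := W ⊓ LinearMap.ker (ρ a) with hW₁
  set W₂ := W₁ ⊓ LinearMap.ker (ρ b) with hW₂
  set W₃ := W₂ ⊓ LinearMap.ker (ρ c) with hW₃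
  have h1 := finrank_eq_finrank_map_add_finrank_inf_ker W (ρ a)
  have h2 := finrank_eq_finrank_map_add_finrank_inf_ker W₁ (ρ b)
  have h3 := finrank_eq_finrank_map_add_finrank_inf_ker W₂ (ρ c)
  rw [← hW₁] at h1; rw [← hW₂] at h2; rw [← hW₃] at h3
  have m1 := hrow' a
  have m2 : finrank K (W₁.map (ρ b)) ≤ 2 :=
    (Submodule.finrank_mono (Submodule.map_mono inf_le_left)).trans (hrow' b)
  have m3 : finrank K (W₂.map (ρ c)) ≤ 2 :=
    (Submodule.finrank_mono (Submodule.map_mono (inf_le_left.trans inf_le_left))).trans (hrow' c)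
  have hpos : 0 < finrank K W₃ := by omega
  obtain ⟨⟨z, hz⟩, hz0⟩ := (Module.finrank_pos_iff_exists_ne_zero).1 hpos
  have hz' : z ∈ W ∧ (∀ l, z (a, l) = 0) ∧ (∀ l, z (b, l) = 0) ∧ ∀ l, z (c, l) = 0 := by
    simp only [hW₃, hW₂, hW₁, Submodule.mem_inf, LinearMap.mem_ker] at hz
    exact ⟨hz.1.1.1, fun l => by have := congr_fun hz.1.1.2 l; rwa [hρ] at this,
      fun l => by have := congr_fun hz.1.2 l; rwa [hρ] at this,
      fun l => by have := congr_fun hz.2 l; rwa [hρ] at this⟩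
  refine ⟨z, hz'.1, fun h => hz0 (Subtype.ext h), fun i hi l => ?_⟩
  rcases hall i with h | h | h | h
  · exact absurd h hi
  · rw [h]; exact hz'.2.1 l
  · rw [h]; exact hz'.2.2.1 l
  · rw [h]; exact hz'.2.2.2 l

/-- **Single-column elements** (transpose of `exists_single_row`). [folklore] -/
theorem exists_single_col (W : Submodule K (Fin 4 × Fin 4 → K))
    (hcol : ∀ l : Fin 4, finrank K (W.map (LinearMap.funLeft K K fun i : Fin 4 => (i, l))) ≤ 2)
    (h7 : 7 ≤ finrank K W) (j : Fin 4) :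
    ∃ z ∈ W, z ≠ 0 ∧ ∀ l, l ≠ j → ∀ i, z (i, l) = 0 := by
  set τ := LinearEquiv.funCongrLeft K K (Equiv.prodComm (Fin 4) (Fin 4)) with hτ
  have hτy : ∀ (y : Fin 4 × Fin 4 → K) (i k : Fin 4), τ y (i, k) = y (k, i) := fun _ _ _ => rfl
  have hrowT : ∀ r : Fin 4, finrank K ((W.map τ.toLinearMap).map
      (LinearMap.funLeft K K fun l : Fin 4 => (r, l))) ≤ 2 := by
    intro r
    have hcomp : (LinearMap.funLeft K K fun l : Fin 4 => (r, l)) ∘ₗ τ.toLinearMap =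
        LinearMap.funLeft K K fun i : Fin 4 => (i, r) := by
      apply LinearMap.ext; intro x; funext i; rfl
    rw [← Submodule.map_comp, hcomp]
    exact hcol r
  obtain ⟨z, hz, hz0, hzr⟩ := exists_single_row (W.map τ.toLinearMap) hrowT
    (by rw [LinearEquiv.finrank_map_eq]; exact h7) j
  obtain ⟨y, hy, rfl⟩ := hz
  refine ⟨y, hy, fun h => hz0 (by rw [h, map_zero]), fun l hl i => ?_⟩
  have := hzr l hl i
  rwa [LinearEquiv.coe_toLinearMap, hτy] at this

/-- **Single row + single row + single column** under H3: `ζ_{ij} · per₂ = 0`. [folklore] -/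
theorem unit_col_mul_perm_eq_zero (W : Submodule K (Fin 4 × Fin 4 → K))
    (hW3 : ∀ x ∈ W, ∀ (r c : Fin 3 → Fin 4), Function.Injective r → Function.Injective c →
      ((Matrix.of fun i j => x (i, j)).submatrix r c).permanent = 0)
    {b c i j p q : Fin 4} (hbc : b ≠ c) (hib : i ≠ b) (hic : i ≠ c) (hpq : p ≠ q) (hjp : j ≠ p)
    (hjq : j ≠ q) {z₁ z₂ ζ : Fin 4 × Fin 4 → K} (hz₁ : z₁ ∈ W) (hz₂ : z₂ ∈ W) (hζ : ζ ∈ W)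
    (hz₁s : ∀ i', i' ≠ b → ∀ l, z₁ (i', l) = 0) (hz₂s : ∀ i', i' ≠ c → ∀ l, z₂ (i', l) = 0)
    (hζs : ∀ l, l ≠ j → ∀ i', ζ (i', l) = 0) :
    ζ (i, j) * (z₁ (b, p) * z₂ (c, q) + z₁ (b, q) * z₂ (c, p)) = 0 := by
  have hinjr : Function.Injective ![i, b, c] := injective_vec_three hib hic hbc
  have hinjc : Function.Injective ![j, p, q] := injective_vec_three hjp hjq hpq
  have h := hW3 (z₁ + z₂ + ζ) (W.add_mem (W.add_mem hz₁ hz₂) hζ) ![i, b, c] ![j, p, q] hinjr hinjc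
  rw [Matrix.permanent_fin_three_row] at h
  simp only [Matrix.submatrix_apply, Matrix.of_apply, Matrix.cons_val_zero, Matrix.cons_val_one,
    Matrix.cons_val, Pi.add_apply, hz₁s i hib, hz₂s i hic, hζs p hjp.symm, hζs q hjq.symm,
    hz₂s b hbc, hz₁s c hbc.symm, zero_add, add_zero, zero_mul] at h
  linear_combination h

/-- **A matrix unit in `W` kills the complementary `2 × 2` subpermanents.** [folklore] -/
theorem perm_two_of_unit (W : Submodule K (Fin 4 × Fin 4 → K))
    (hW3 : ∀ x ∈ W, ∀ (r c : Fin 3 → Fin 4), Function.Injective r → Function.Injective c →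
      ((Matrix.of fun i j => x (i, j)).submatrix r c).permanent = 0)
    {r j : Fin 4} (hunit : (Pi.single (r, j) (1 : K) : Fin 4 × Fin 4 → K) ∈ W)
    {b c p q : Fin 4} (hbr : b ≠ r) (hcr : c ≠ r) (hbc : b ≠ c) (hpj : p ≠ j) (hqj : q ≠ j)
    (hpq : p ≠ q) {x : Fin 4 × Fin 4 → K} (hx : x ∈ W) :
    x (b, p) * x (c, q) + x (b, q) * x (c, p) = 0 := by
  classical
  have hinjr : Function.Injective ![r, b, c] := injective_vec_three hbr.symm hcr.symm hbc
  have hinjc : Function.Injective ![j, p, q] := injective_vec_three hpj.symm hqj.symm hpq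
  set E : Fin 4 × Fin 4 → K := Pi.single (r, j) 1 with hE
  have hE1 : E (r, j) = 1 := by rw [hE, Pi.single_eq_same]
  have hE0 : ∀ pr : Fin 4 × Fin 4, pr ≠ (r, j) → E pr = 0 := fun pr h => by
    rw [hE, Pi.single_eq_of_ne h]
  have P : ∀ t : K, ((Matrix.of fun i j' => (x + t • E) (i, j')).submatrix ![r, b, c] ![j, p, q]).permanent
      = 0 := fun t => hW3 (x + t • E) (W.add_mem hx (W.smul_mem t hunit)) _ _ hinjr hinjc
  have h0 := P 0
  have h1 := P 1
  rw [Matrix.permanent_fin_three_row] at h0 h1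
  simp only [Matrix.submatrix_apply, Matrix.of_apply, Matrix.cons_val_zero, Matrix.cons_val_one,
    Matrix.cons_val, Pi.add_apply, Pi.smul_apply, smul_eq_mul, zero_mul, add_zero, one_mul, hE1,
    hE0 (r, p) (fun h => hpj (Prod.mk.inj h).2), hE0 (r, q) (fun h => hqj (Prod.mk.inj h).2),
    hE0 (b, j) (fun h => hbr (Prod.mk.inj h).1), hE0 (b, p) (fun h => hbr (Prod.mk.inj h).1),
    hE0 (b, q) (fun h => hbr (Prod.mk.inj h).1), hE0 (c, j) (fun h => hcr (Prod.mk.inj h).1),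
    hE0 (c, p) (fun h => hcr (Prod.mk.inj h).1), hE0 (c, q) (fun h => hcr (Prod.mk.inj h).1)] at h0 h1
  linear_combination h1 - h0

/-- **A matrix unit forces `dim W ≤ 6`** (rows and columns of rank `≤ 2`, H3). [folklore] -/
theorem finrank_le_six_of_unit [CharZero K] (W : Submodule K (Fin 4 × Fin 4 → K))
    (hW3 : ∀ x ∈ W, ∀ (r c : Fin 3 → Fin 4), Function.Injective r → Function.Injective c →
      ((Matrix.of fun i j => x (i, j)).submatrix r c).permanent = 0)
    (hrow : ∀ r : Fin 4, finrank K (W.map (LinearMap.funLeft K K fun l : Fin 4 => (r, l))) ≤ 2)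
    (hcol : ∀ l : Fin 4, finrank K (W.map (LinearMap.funLeft K K fun i : Fin 4 => (i, l))) ≤ 2)
    {r j : Fin 4} (hunit : (Pi.single (r, j) (1 : K) : Fin 4 × Fin 4 → K) ∈ W) :
    finrank K W ≤ 6 := by
  classical
  obtain ⟨b, c, d, hbc, hbd, hcd, hbr, hcr, hdr, hrows⟩ := exists_three_others r
  obtain ⟨p, q, s, hpq, hps, hqs, hpj, hqj, hsj, hcols⟩ := exists_three_others j
  let ρ : (Fin 4 × Fin 4 → K) →ₗ[K] (Fin 4 → K) := LinearMap.funLeft K K fun l : Fin 4 => (r, l)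
  let γ : (Fin 4 × Fin 4 → K) →ₗ[K] (Fin 4 → K) := LinearMap.funLeft K K fun i : Fin 4 => (i, j)
  have hρ : ∀ x l, ρ x l = x (r, l) := fun _ _ => rfl
  have hγ : ∀ x i, γ x i = x (i, j) := fun _ _ => rfl
  set W₁ := W ⊓ LinearMap.ker ρ with hW₁
  set W₂ := W₁ ⊓ LinearMap.ker γ with hW₂
  have h1 := finrank_eq_finrank_map_add_finrank_inf_ker W ρ
  have h2 := finrank_eq_finrank_map_add_finrank_inf_ker W₁ γ
  rw [← hW₁] at h1; rw [← hW₂] at h2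
  have m1 : finrank K (W.map ρ) ≤ 2 := hrow r
  have m2 : finrank K (W₁.map γ) ≤ 2 :=
    (Submodule.finrank_mono (Submodule.map_mono inf_le_left)).trans (hcol j)
  have memW₂ : ∀ x, x ∈ W₂ → x ∈ W ∧ (∀ l, x (r, l) = 0) ∧ ∀ i, x (i, j) = 0 := by
    intro x hx
    simp only [hW₂, hW₁, Submodule.mem_inf, LinearMap.mem_ker] at hx
    exact ⟨hx.1.1, fun l => by have := congr_fun hx.1.2 l; rwa [hρ] at this,
      fun i => by have := congr_fun hx.2 i; rwa [hγ] at this⟩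
  have hle2 : W₂ ≤ W := inf_le_left.trans inf_le_left
  have hblock := finrank_le_two_of_block_perm W₂ r b c d hbr.symm hcr.symm hdr.symm hbc hbd hcd
    p q s j hpq hps hqs hpj.symm hqj.symm hsj.symm
    (fun l => by rcases hcols l with h | h | h | h <;> simp [h])
    (fun x hx => (memW₂ x hx).2.1) (fun x hx => (memW₂ x hx).2.2)
    (fun x hx r₁ r₂ h₁ h₂ h₁₂ l l' hll' => by
      obtain ⟨hxW, -, hxj⟩ := memW₂ x hx
      by_cases hl : l = j
      · rw [hl, hxj, hxj, mul_zero, zero_mul, add_zero]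
      by_cases hl' : l' = j
      · rw [hl', hxj, hxj, mul_zero, zero_mul, add_zero]
      exact perm_two_of_unit W hW3 hunit h₁ h₂ h₁₂ hl hl' hll' hxW)
    (fun r' => (Submodule.finrank_mono (Submodule.map_mono hle2)).trans (hrow r'))
    (fun l => (Submodule.finrank_mono (Submodule.map_mono hle2)).trans (hcol l))
  omega

/-- **The toric case**: H3 and all rows and columns of rank `≤ 2` force `dim W ≤ 6`. [folklore] -/
theorem finrank_le_six_of_ranks_le_two [CharZero K] (W : Submodule K (Fin 4 × Fin 4 → K))
    (hW3 : ∀ x ∈ W, ∀ (r c : Fin 3 → Fin 4), Function.Injective r → Function.Injective c →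
      ((Matrix.of fun i j => x (i, j)).submatrix r c).permanent = 0)
    (hrow : ∀ r : Fin 4, finrank K (W.map (LinearMap.funLeft K K fun l : Fin 4 => (r, l))) ≤ 2)
    (hcol : ∀ l : Fin 4, finrank K (W.map (LinearMap.funLeft K K fun i : Fin 4 => (i, l))) ≤ 2) :
    finrank K W ≤ 6 := by
  classical
  by_contra hgt
  push Not at hgt
  have h7 : 7 ≤ finrank K W := by omega
  -- a single-column element in column `0`, and a row `a` in its support
  obtain ⟨ζ, hζ, hζ0, hζs⟩ := exists_single_col W hcol h7 0
  obtain ⟨a, ha⟩ : ∃ a, ζ (a, 0) ≠ 0 := by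
    by_contra h
    push Not at h
    exact hζ0 (funext fun ⟨i, l⟩ => by
      by_cases hl : l = 0
      · rw [hl]; exact h i
      · exact hζs l hl i)
  obtain ⟨b, c, d, hbc, hbd, hcd, hba, hca, hda, hrows⟩ := exists_three_others a
  obtain ⟨p, q, s, hpq, hps, hqs, hp0, hq0, hs0, hcols⟩ := exists_three_others (0 : Fin 4)
  -- single-row elements in rows `b, c, d`
  obtain ⟨zb, hzb, hzb0, hzbs⟩ := exists_single_row W hrow h7 b
  obtain ⟨zc, hzc, hzc0, hzcs⟩ := exists_single_row W hrow h7 c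
  obtain ⟨zd, hzd, hzd0, hzds⟩ := exists_single_row W hrow h7 d
  -- their rows with the column-`0` entry removed
  let cut : Fin 4 → (Fin 4 × Fin 4 → K) → Fin 4 → K := fun r' z l => if l = 0 then 0 else z (r', l)
  have hcut0 : ∀ r' z, cut r' z 0 = 0 := fun _ _ => by simp [cut]
  have hcutne : ∀ r' z l, l ≠ 0 → cut r' z l = z (r', l) := fun _ _ _ hl => by simp [cut, hl]
  -- pairwise perm-orthogonality from H3 with `ζ`
  have horth : ∀ {r₁ r₂ : Fin 4} {z₁ z₂ : Fin 4 × Fin 4 → K}, r₁ ≠ r₂ → a ≠ r₁ → a ≠ r₂ →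
      z₁ ∈ W → z₂ ∈ W → (∀ i', i' ≠ r₁ → ∀ l, z₁ (i', l) = 0) → (∀ i', i' ≠ r₂ → ∀ l, z₂ (i', l) = 0) →
      ∀ l l' : Fin 4, l ≠ l' → cut r₁ z₁ l * cut r₂ z₂ l' + cut r₁ z₁ l' * cut r₂ z₂ l = 0 := by
    intro r₁ r₂ z₁ z₂ h12 ha1 ha2 hz₁ hz₂ hz₁s hz₂s l l' hll'
    by_cases hl : l = 0
    · rw [hl, hcut0, hcut0, zero_mul, mul_zero, add_zero]
    by_cases hl' : l' = 0
    · rw [hl', hcut0, hcut0, zero_mul, mul_zero, add_zero]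
    rw [hcutne _ _ _ hl, hcutne _ _ _ hl', hcutne _ _ _ hl, hcutne _ _ _ hl']
    have h := unit_col_mul_perm_eq_zero W hW3 h12 ha1 ha2 hll' (Ne.symm hl) (Ne.symm hl') hz₁ hz₂ hζ
      hz₁s hz₂s hζs
    exact (mul_eq_zero.1 h).resolve_left ha
  -- Case (i): one of them vanishes off column `0`: a matrix unit
  have unit_of : ∀ {r' : Fin 4} {z : Fin 4 × Fin 4 → K}, z ∈ W → z ≠ 0 →
      (∀ i', i' ≠ r' → ∀ l, z (i', l) = 0) → cut r' z = 0 →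
      (Pi.single (r', 0) (1 : K) : Fin 4 × Fin 4 → K) ∈ W := by
    intro r' z hz hz0 hzs hcz
    have hzr0 : z (r', 0) ≠ 0 := by
      intro h0
      apply hz0
      funext ⟨i, l⟩
      by_cases hi : i = r'
      · rw [hi]
        by_cases hl : l = 0
        · rw [hl]; exact h0
        · have := congr_fun hcz l; rwa [hcutne _ _ _ hl, Pi.zero_apply] at this
      · exact hzs i hi l
    have hE : (Pi.single (r', 0) (1 : K) : Fin 4 × Fin 4 → K) = (z (r', 0))⁻¹ • z := by
      funext ⟨i, l⟩
      rw [Pi.smul_apply, smul_eq_mul]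
      by_cases h : (i, l) = (r', 0)
      · rw [h, Pi.single_eq_same, inv_mul_cancel₀ hzr0]
      · rw [Pi.single_eq_of_ne h]
        by_cases hi : i = r'
        · subst hi
          have hl : l ≠ 0 := fun hl => h (by rw [hl])
          have := congr_fun hcz l
          rw [hcutne _ _ _ hl, Pi.zero_apply] at this
          rw [this, mul_zero]
        · rw [hzs i hi l, mul_zero]
    rw [hE]
    exact W.smul_mem _ hz
  by_cases hb0 : cut b zb = 0
  · have := finrank_le_six_of_unit W hW3 hrow hcol (unit_of hzb hzb0 hzbs hb0); omega
  by_cases hc0 : cut c zc = 0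
  · have := finrank_le_six_of_unit W hW3 hrow hcol (unit_of hzc hzc0 hzcs hc0); omega
  by_cases hd0 : cut d zd = 0
  · have := finrank_le_six_of_unit W hW3 hrow hcol (unit_of hzd hzd0 hzds hd0); omega
  -- Case (ii): common one-point support `l₀`: column `l₀` has rank `3`
  obtain ⟨l₀, hl₀, hsupp⟩ := common_support_of_perm_orth₃ p q s 0 hpq hps hqs hp0.symm hq0.symm
    hs0.symm (fun l => by rcases hcols l with h | h | h | h <;> simp [h])
    (cut b zb) (cut c zc) (cut d zd) (hcut0 _ _) (hcut0 _ _) (hcut0 _ _) hb0 hc0 hd0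
    (horth hbc hba.symm hca.symm hzb hzc hzbs hzcs)
    (horth hbd hba.symm hda.symm hzb hzd hzbs hzds)
    (horth hcd hca.symm hda.symm hzc hzd hzcs hzds)
  -- the `l₀`-entries are non-zero
  have nzb : zb (b, l₀) ≠ 0 := fun h0 => hb0 (funext fun l => by
    by_cases hl : l = l₀
    · rw [hl, hcutne _ _ _ hl₀, h0]; rfl
    · exact (hsupp l hl).1)
  have nzc : zc (c, l₀) ≠ 0 := fun h0 => hc0 (funext fun l => by
    by_cases hl : l = l₀
    · rw [hl, hcutne _ _ _ hl₀, h0]; rfl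
    · exact (hsupp l hl).2.1)
  have nzd : zd (d, l₀) ≠ 0 := fun h0 => hd0 (funext fun l => by
    by_cases hl : l = l₀
    · rw [hl, hcutne _ _ _ hl₀, h0]; rfl
    · exact (hsupp l hl).2.2)
  -- the column `l₀` map sends `zb, zc, zd` to multiples of `e_b, e_c, e_d`
  let γ : (Fin 4 × Fin 4 → K) →ₗ[K] (Fin 4 → K) := LinearMap.funLeft K K fun i : Fin 4 => (i, l₀)
  have hγ : ∀ x i, γ x i = x (i, l₀) := fun _ _ => rfl
  have himg : ∀ {r' : Fin 4} {z : Fin 4 × Fin 4 → K}, z ∈ W → (∀ i', i' ≠ r' → ∀ l, z (i', l) = 0) →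
      z (r', l₀) ≠ 0 → (Pi.single r' (1 : K) : Fin 4 → K) ∈ W.map γ := by
    intro r' z hz hzs hnz
    have hγz : γ z = z (r', l₀) • (Pi.single r' (1 : K) : Fin 4 → K) := by
      funext i
      rw [hγ, Pi.smul_apply, smul_eq_mul]
      by_cases hi : i = r'
      · rw [hi, Pi.single_eq_same, mul_one]
      · rw [Pi.single_eq_of_ne hi, mul_zero]; exact hzs i hi l₀
    have hmem : γ z ∈ W.map γ := ⟨z, hz, rfl⟩
    rw [hγz] at hmem
    have := (W.map γ).smul_mem (z (r', l₀))⁻¹ hmem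
    rwa [smul_smul, inv_mul_cancel₀ hnz, one_smul] at this
  have hinj : Function.Injective ![b, c, d] := injective_vec_three hbc hbd hcd
  have hli : LinearIndependent K (⇑(Pi.basisFun K (Fin 4)) ∘ ![b, c, d]) :=
    (Pi.basisFun K (Fin 4)).linearIndependent.comp ![b, c, d] hinj
  have hval : ∀ k : Fin 3, (⇑(Pi.basisFun K (Fin 4)) ∘ ![b, c, d]) k =
      (Pi.single (![b, c, d] k) (1 : K) : Fin 4 → K) := fun k => by
    rw [Function.comp_apply, Pi.basisFun_apply]
  have hspan : Submodule.span K (Set.range (⇑(Pi.basisFun K (Fin 4)) ∘ ![b, c, d])) ≤ W.map γ := by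
    rw [Submodule.span_le]
    rintro _ ⟨k, rfl⟩
    rw [SetLike.mem_coe, hval]
    fin_cases k
    · exact himg hzb hzbs nzb
    · exact himg hzc hzcs nzc
    · exact himg hzd hzds nzd
  have h3 : finrank K (Submodule.span K (Set.range (⇑(Pi.basisFun K (Fin 4)) ∘ ![b, c, d]))) = 3 := by
    rw [finrank_span_eq_card hli, Fintype.card_fin]
  have hge := Submodule.finrank_mono hspan
  have hc : finrank K (W.map γ) ≤ 2 := hcol l₀
  omega

/-- **Task T1.**  Under H3 and the swapped property with `< 6` squares (`rank (Hess per_4) ≤ 5`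
on `W`): `dim W ≤ 6`. [folklore] -/
theorem finrank_le_six_of_sum_sq_swap [CharZero K] {ι : Type*} [Fintype ι]
    (hι : Fintype.card ι < 6) (W : Submodule K (Fin 4 × Fin 4 → K))
    (hW3 : ∀ x ∈ W, ∀ (r c : Fin 3 → Fin 4), Function.Injective r → Function.Injective c →
      ((Matrix.of fun i j => x (i, j)).submatrix r c).permanent = 0)
    (hW : ∀ y ∈ W, ∃ (c : ι → K) (Λ : ι → ((Fin 4 × Fin 4 → K) →ₗ[K] K)),
      ∀ u : Fin 4 × Fin 4 → K, ∃ e₀ e₁ : K, ∀ s : K,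
        eval (u + s • y) (perPoly (Fin 4) K) = e₀ + s * e₁ + s ^ 2 * ∑ k, c k * (Λ k u) ^ 2) :
    finrank K W ≤ 6 :=
  finrank_le_six_of_toric hι W hW3 hW fun hrow hcol => finrank_le_six_of_ranks_le_two W hW3 hrow hcol

end Summit.ValiantsHypothesis.ValiantsHypothesis.Theorems.SymPencilPerFourHessianToric

end
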